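import Literature.NumberTheory.Automorphic.OrbitalIntegralFixedPointWeighted   -- ★ `classOrbitalIntegral_eq_sum_fixedBy_of_support_subset_of_conj_invariant`, ★ `finite_fixedBy_quotient_of_isClosed`
import HarnessLib

/-!
# The orbital integral of a piece constant on STRATA of `K` is a weighted count of the fixed cosets by stratum:
# `O_γ(f) = ν(K) · Σ_r c_r · #{q ∈ Fix_γ(G ⧸ K) : ρ(q.out⁻¹ γ q.out) = r}`

Topic `NumberTheory/Automorphic`; namespace `Literature.NumberTheory.Automorphic`.  THEOREMS ONLY (no definition, no instance, no notation, no named fact,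
no `sorry`); generic topological-group bookkeeping over ★ `OrbitalIntegralFixedPointWeighted` (the weighted unfolding
`classOrbitalIntegral m f ⟦γ⟧ = ν(K) · Σ_{q ∈ Fix_γ(G⧸K)} f(q.out⁻¹ γ q.out)`).  Cell `pub/hodgecm-mathlib` (D-0151), crux H413 = `stmt-HodgeConjecture-24833`; road
«S3-tree» (LEAD F0P3a-plan (g11), architect A-p16 (g29) A-65 (1)), brick T3′ «depth-zero κ-transfer» (holder F0P3b-p01 (g11), DESIGN v1 419b4e54 §2 O8), organ
**O8b «THE FOUR VALUES OF g»** (A-p12 (g21)): the value of the orbital integral of a depth-zero piece `g = Σ_r c_r ψ_r` (constant `= c_r` on the residually-unipotent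
Jordan stratum `r` of `K`) at a DEEP class `γ` (every conjugate of `γ` inside `K` is residually unipotent) is `ν(K) · Σ_r c_r · n_r(γ)`, `n_r(γ)` the number of
`γ`-fixed cosets of `G ⧸ K` in stratum `r`.  HONEST LABEL: HC_CM is proved only modulo the 2 remaining named inputs (hLiu418 24832, h413 24833) until rung 0
closes; nothing printed is asserted here.

THE MATHEMATICS.  `G` locally compact, second countable, Hausdorff; `K ≤ G` compact open; `ν` a Haar measure; `m` an orbital-measure family CANONICAL for
`(P, ν)`; `γ ∈ G` with `P γ`, compact centraliser and closed class (so `Fix_γ(G ⧸ K)` is finite, ★ `finite_fixedBy_quotient_of_isClosed`).  A «stratification» is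
ANY label `ρ : G → ℕ` and ANY «unipotent locus» `U ⊆ G`; a piece `f` (continuous, supported in `K`, `K`-conjugation invariant) is «constant on strata» if
`f k = c (ρ k)` for `k ∈ K ∩ U`, and `γ` is «deep» if `x⁻¹ γ x ∈ K ⇒ x⁻¹ γ x ∈ U`.  Then (§1, finite regrouping) `Σ_{q ∈ Fix} f(q.out⁻¹ γ q.out) =
Σ_{r<N} #{q ∈ Fix : ρ(q.out⁻¹ γ q.out) = r} · c_r` whenever `ρ < N` on `K ∩ U`, and (§2) **`classOrbitalIntegral m f ⟦γ⟧ = ν(K) · Σ_{r<N} n_r(γ) · c_r`**.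
Consumers instantiate `ρ k = rank (red(k_w) − 1)`, `U = {(red(k_w) − 1)^3 = 0}`, `N = 3` (T3′ HEAD v2 9fec650d's `hc`), and read `n₀` from the level-shift
dictionary (★ `FixedCosetsLevelShift`), `n₂` from ★ `ResiduallyUnipotentCyclicLattices` (free of rank one over `𝒪[γ]`) and `n₀+n₁+n₂ = #Fix` from the unit count.

* §1 `setOf_mem_and_eq_eq_coe_filter`, **`finsum_mem_eq_sum_range_ncard_smul`** (regrouping a finite sum by the strata of a label).
* §2 `inv_out_mul_mul_out_mem_of_mem_fixedBy`, **`classOrbitalIntegral_eq_smul_sum_ncard_strata`**, `…_of_measure_eq_one`, and the stratum-total identity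
  `sum_range_ncard_strata_eq_ncard_fixedBy` (`Σ_r n_r = #Fix`).

## References
* [Rogawski1990] J. D. Rogawski, *Automorphic Representations of Unitary Groups in Three Variables* (1990): §4.9 p. 54 (orbital integrals as lattice counts), §4.3 p. 43.
* [Laumon1995] G. Laumon, *Cohomology of Drinfeld Modular Varieties* I (1996): Lemma (5.3.2) p. 136.
* [Kottwitz1986] R. E. Kottwitz, *Base change for unit elements of Hecke algebras*, Compositio Math. 60 (1986): §3.
-/

set_option autoImplicit false

noncomputable section

open MeasureTheory Measure Topology Filter Set Function

namespace Literature.NumberTheory.Automorphic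

/-! ## §1 Regrouping a finite sum by the strata of a label -/

section Regroup

variable {α M : Type*} [AddCommMonoid M]

/-- The stratum `{a ∈ S | ρ a = r}` of a finite set is the filter of its `Finset`. [cite: Laumon1995, Lemma (5.3.2) p. 136] -/
theorem setOf_mem_and_eq_eq_coe_filter [DecidableEq ℕ] {S : Set α} (hS : S.Finite) (ρ : α → ℕ) (r : ℕ) :
    {a : α | a ∈ S ∧ ρ a = r} = ↑(hS.toFinset.filter fun a => ρ a = r) := by
  ext a
  rw [Set.mem_setOf_eq, Finset.coe_filter, Set.mem_setOf_eq, Set.Finite.mem_toFinset]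

/-- **REGROUPING BY STRATA**: if `f a = c (ρ a)` and `ρ a < N` on a finite `S`, then `Σ_{a ∈ S} f a = Σ_{r < N} #{a ∈ S : ρ a = r} • c r`.
[cite: Laumon1995, Lemma (5.3.2) p. 136] -/
theorem finsum_mem_eq_sum_range_ncard_smul {S : Set α} (hS : S.Finite) (f : α → M) (ρ : α → ℕ) (c : ℕ → M) (N : ℕ)
    (hf : ∀ a ∈ S, f a = c (ρ a)) (hρ : ∀ a ∈ S, ρ a < N) :
    ∑ᶠ a ∈ S, f a = ∑ r ∈ Finset.range N, ({a : α | a ∈ S ∧ ρ a = r}.ncard) • c r := by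
  classical
  rw [finsum_mem_eq_finite_toFinset_sum f hS]
  have h1 : ∑ a ∈ hS.toFinset, f a = ∑ a ∈ hS.toFinset, c (ρ a) :=
    Finset.sum_congr rfl fun a ha => hf a (hS.mem_toFinset.1 ha)
  rw [h1, ← Finset.sum_fiberwise_of_maps_to' (t := Finset.range N) (g := ρ)
    (fun a ha => Finset.mem_range.2 (hρ a (hS.mem_toFinset.1 ha))) c]
  refine Finset.sum_congr rfl fun r _ => ?_
  rw [Finset.sum_const, setOf_mem_and_eq_eq_coe_filter hS ρ r, Set.ncard_coe_finset]

end Regroup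

/-! ## §2 The orbital integral of a piece constant on strata -/

section Strata

variable {G : Type*} [Group G]

/-- For a `γ`-fixed coset `q`, the conjugate `q.out⁻¹ γ q.out` lies in `K`. [cite: Kottwitz1986, §3] -/
theorem inv_out_mul_mul_out_mem_of_mem_fixedBy (K : Subgroup G) (γ : G) {q : G ⧸ K} (hq : q ∈ MulAction.fixedBy (G ⧸ K) γ) :
    q.out⁻¹ * γ * q.out ∈ K := by
  rw [MulAction.mem_fixedBy, ← QuotientGroup.out_eq' q, MulAction.Quotient.smul_mk, smul_eq_mul, QuotientGroup.eq] at hq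
  have h : (γ * q.out)⁻¹ * q.out = (q.out⁻¹ * γ * q.out)⁻¹ := by group
  rw [h] at hq
  exact (inv_mem_iff).1 hq

variable [TopologicalSpace G] [IsTopologicalGroup G] [LocallyCompactSpace G] [SecondCountableTopology G] [T2Space G]

/-- **THE STRATA EXHAUST THE FIXED COSETS**: `Σ_{r<N} #{q ∈ Fix : ρ(q.out⁻¹ γ q.out) = r} = #Fix_γ(G ⧸ K)` for a deep `γ` (the unit row `n₀+n₁+n₂ = #Fix`).
[cite: Kottwitz1986, §3] [cite: Rogawski1990, §4.9 p. 54] -/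
theorem sum_range_ncard_strata_eq_ncard_fixedBy (γ : G) [CompactSpace (Subgroup.centralizer ({γ} : Set G))]
    (K : Subgroup G) (hK : IsOpen (K : Set G)) (hKc : IsCompact (K : Set G)) (hO : IsClosed {g | ∃ y : G, y * γ * y⁻¹ = g})
    (U : Set G) (ρ : G → ℕ) (N : ℕ) (hρN : ∀ k ∈ K, k ∈ U → ρ k < N) (hU : ∀ x : G, x⁻¹ * γ * x ∈ K → x⁻¹ * γ * x ∈ U) :
    ∑ r ∈ Finset.range N, {q : G ⧸ K | q ∈ MulAction.fixedBy (G ⧸ K) γ ∧ ρ (q.out⁻¹ * γ * q.out) = r}.ncard = (MulAction.fixedBy (G ⧸ K) γ).ncard := by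
  have hfin := finite_fixedBy_quotient_of_isClosed γ K hO hK hKc
  have hmemK : ∀ q ∈ MulAction.fixedBy (G ⧸ K) γ, q.out⁻¹ * γ * q.out ∈ K := fun q hq => inv_out_mul_mul_out_mem_of_mem_fixedBy K γ hq
  have h := finsum_mem_eq_sum_range_ncard_smul hfin (fun _ => (1 : ℕ)) (fun q => ρ (q.out⁻¹ * γ * q.out)) (fun _ => 1) N
    (fun _ _ => rfl) (fun q hq => hρN _ (hmemK q hq) (hU _ (hmemK q hq)))
  simp only [smul_eq_mul, mul_one] at h
  rw [← h, finsum_mem_eq_finite_toFinset_sum _ hfin, Finset.sum_const, smul_eq_mul, mul_one, Set.ncard_eq_toFinset_card _ hfin]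

variable [MeasurableSpace G] [BorelSpace G]
  [∀ γ : G, MeasurableSpace (G ⧸ Subgroup.centralizer ({γ} : Set G))]
  [∀ γ : G, BorelSpace (G ⧸ Subgroup.centralizer ({γ} : Set G))]
  {E : Type*} [NormedAddCommGroup E] [NormedSpace ℝ E] [CompleteSpace E]

/-- **THE ORBITAL INTEGRAL OF A PIECE CONSTANT ON STRATA IS A WEIGHTED STRATUM COUNT.**  In the setting of ★
`classOrbitalIntegral_eq_sum_fixedBy_of_support_subset_of_conj_invariant` (canonical `m`, `P γ`, compact centraliser, closed class, `K` compact open, `f`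
continuous supported in `K` and `K`-conjugation invariant), if `f k = c (ρ k)` for `k ∈ K ∩ U` with `ρ k < N` there, and `γ` is DEEP for `(K, U)` (`x⁻¹γx ∈ K ⇒
x⁻¹γx ∈ U`), then `classOrbitalIntegral m f ⟦γ⟧ = ν(K) · Σ_{r<N} #{q ∈ Fix_γ(G⧸K) : ρ(q.out⁻¹ γ q.out) = r} • c r`.
[cite: Rogawski1990, §4.9 p. 54] [cite: Laumon1995, Lemma (5.3.2) p. 136] -/
theorem classOrbitalIntegral_eq_smul_sum_ncard_strata {P : G → Prop} (hP : ∀ g x : G, P g → P (x * g * x⁻¹))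
    {ν : Measure G} [ν.IsHaarMeasure] [ν.IsMulRightInvariant] {m : OrbitalMeasureFamily G} (hm : m.IsCanonical P ν)
    {γ : G} (hγ : P γ) [CompactSpace (Subgroup.centralizer ({γ} : Set G))] (K : Subgroup G) (hK : IsOpen (K : Set G))
    (hKc : IsCompact (K : Set G)) (hO : IsClosed {g | ∃ y : G, y * γ * y⁻¹ = g})
    (f : G → E) (hfc : Continuous f) (hf : support f ⊆ (K : Set G)) (hfK : ∀ k ∈ K, ∀ x : G, f (k * x * k⁻¹) = f x)
    (U : Set G) (ρ : G → ℕ) (c : ℕ → E) (N : ℕ) (hcf : ∀ k ∈ K, k ∈ U → f k = c (ρ k)) (hρN : ∀ k ∈ K, k ∈ U → ρ k < N)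
    (hU : ∀ x : G, x⁻¹ * γ * x ∈ K → x⁻¹ * γ * x ∈ U) :
    classOrbitalIntegral m f (ConjClasses.mk γ) =
      ν.real (K : Set G) • ∑ r ∈ Finset.range N, ({q : G ⧸ K | q ∈ MulAction.fixedBy (G ⧸ K) γ ∧ ρ (q.out⁻¹ * γ * q.out) = r}.ncard) • c r := by
  rw [classOrbitalIntegral_eq_sum_fixedBy_of_support_subset_of_conj_invariant hP hm hγ K hK hKc hO f hfc hf hfK]
  congr 1
  have hmemK : ∀ q ∈ MulAction.fixedBy (G ⧸ K) γ, q.out⁻¹ * γ * q.out ∈ K := fun q hq => inv_out_mul_mul_out_mem_of_mem_fixedBy K γ hq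
  exact finsum_mem_eq_sum_range_ncard_smul (finite_fixedBy_quotient_of_isClosed γ K hO hK hKc) _ (fun q => ρ (q.out⁻¹ * γ * q.out)) c N
    (fun q hq => hcf _ (hmemK q hq) (hU _ (hmemK q hq))) (fun q hq => hρN _ (hmemK q hq) (hU _ (hmemK q hq)))

/-- Unit-mass form (`ν(K) = 1`): `classOrbitalIntegral m f ⟦γ⟧ = Σ_{r<N} n_r(γ) • c r`. [cite: Rogawski1990, §4.9 p. 54] -/
theorem classOrbitalIntegral_eq_sum_ncard_strata_of_measure_eq_one {P : G → Prop} (hP : ∀ g x : G, P g → P (x * g * x⁻¹))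
    {ν : Measure G} [ν.IsHaarMeasure] [ν.IsMulRightInvariant] {m : OrbitalMeasureFamily G} (hm : m.IsCanonical P ν)
    {γ : G} (hγ : P γ) [CompactSpace (Subgroup.centralizer ({γ} : Set G))] (K : Subgroup G) (hK : IsOpen (K : Set G))
    (hKc : IsCompact (K : Set G)) (hν : ν K = 1) (hO : IsClosed {g | ∃ y : G, y * γ * y⁻¹ = g})
    (f : G → E) (hfc : Continuous f) (hf : support f ⊆ (K : Set G)) (hfK : ∀ k ∈ K, ∀ x : G, f (k * x * k⁻¹) = f x)
    (U : Set G) (ρ : G → ℕ) (c : ℕ → E) (N : ℕ) (hcf : ∀ k ∈ K, k ∈ U → f k = c (ρ k)) (hρN : ∀ k ∈ K, k ∈ U → ρ k < N)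
    (hU : ∀ x : G, x⁻¹ * γ * x ∈ K → x⁻¹ * γ * x ∈ U) :
    classOrbitalIntegral m f (ConjClasses.mk γ) =
      ∑ r ∈ Finset.range N, ({q : G ⧸ K | q ∈ MulAction.fixedBy (G ⧸ K) γ ∧ ρ (q.out⁻¹ * γ * q.out) = r}.ncard) • c r := by
  rw [classOrbitalIntegral_eq_smul_sum_ncard_strata hP hm hγ K hK hKc hO f hfc hf hfK U ρ c N hcf hρN hU, Measure.real, hν,
    ENNReal.toReal_one, one_smul]

end Strata

end Literature.NumberTheory.Automorphic

end
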